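import Summits.Ventures.PercRepro.Night2LineLoad
import Summits.Ventures.PercRepro.Night2LineFaces
import Summits.Ventures.PercRepro.Night2NonFatStructure

/-!
# night-2: THE UNLOADED TARGETS OF THE HITTING PROGRAMME (gen 39)

Tools for the hitting targets of a lossy basis pair `(B, z)` of the non-fat cell `(2, 1)` (`Q = B ∪ {z}`, `Q′ = Q ∖ K` a
basis of `V`, `W = G ∖ Q`, targets `Q ∪ Y`, `T′ = T ∖ K = Q′ ∪ Y`).  A loaded target contains a rank-2 set `R ⊆ T′` with
`|T′| ≤ |R| + 5` (`exists_rank_two_of_dload_ne_zero`), and `R` meets the independent set `Q′` in at most two points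
(`card_inter_le_two_of_indep_of_rkN_le_two`).  Hence
* **`dload_eq_zero_of_line_target_four`**: for ANY closure `ℓ = cl B₀`, the target `Q ∪ (Y_D ∪ Y_O)` with `Y_D ⊆ W ∩ ℓ`,
  `|Y_D| ≥ 4`, `Y_O ⊆ W ∖ ℓ` and `|Y_O| > |Q′ ∩ ℓ|` is unloaded (`R ⊆ ℓ` forces `|Y_D| + |Y_O| ≤ |Q′ ∩ ℓ| + |Y_D|`; `R ⊄ ℓ`
  forces `|R| ≤ 1 + 2 + |Y_O|`, so `|Y_D| ≤ 3`) — the four-point form of gen 38's line lemma (which needed `5` points on a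
  basis line and `7` on an arbitrary one);
* **`dload_eq_zero_of_level_of_lines_le`**: if every line carries at most `L` points of `W`, every target of level
  `|Y| ≥ L + 3` is unloaded (`R ∩ Y` has `≥ |Y| − 2 ≥ L + 1` collinear points of `W`);
* **`card_facesIn_le_choose`**, **`faceSum_le_third_mul_choose`**: the member faces inside `T` are at most `C(|T′|, 4)`, so
  `faceSum T ≤ C(|T′|, 4) / 3` with no fat closure.
Paper: proofs/NIGHT-2-g39.md §1.
-/

namespace PercRepro.Shadow

open PercRepro.ThmH PercRepro.PerFlat

variable {α : Type*} [DecidableEq α] {M : Matroid α} [M.Finite] {G : Finset α}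

/-- An independent set meets a set of rank `≤ 2` in at most two points. -/
theorem card_inter_le_two_of_indep_of_rkN_le_two {S R : Finset α} (hS : M.Indep (S : Set α))
    (hR : rkN M R ≤ 2) : (S ∩ R).card ≤ 2 := by
  have hind : M.Indep ((S ∩ R : Finset α) : Set α) :=
    hS.subset (by exact_mod_cast (Finset.inter_subset_left))
  have h1 := rkN_eq_card_of_indep hind
  have h2 : rkN M (S ∩ R) ≤ rkN M R := rkN_mono Finset.inter_subset_right
  omega

/-- The off-coloop part of a target `Q ∪ Y` (`Y ⊆ W`) is `Q′ ∪ Y`. -/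
theorem union_sdiff_coloops_eq_of_subset (hG : G ∈ flatsQ M (5 + 1)) (hd : (gr M \ G).card = 2)
    {B : Finset α} (hB : B ∈ thinMembers M 5 G) {z : α} {Y : Finset α} (hY : Y ⊆ G \ insert z B) :
    (insert z B ∪ Y) \ coloops M G = (insert z B \ coloops M G) ∪ Y := by
  have hd' : (gr M \ G).card ≤ 5 := by omega
  have hKB : coloops M G ⊆ B := coloops_subset_of_mem_thinMembers hG hd' hB
  ext x
  simp only [Finset.mem_sdiff, Finset.mem_union]
  constructor
  · rintro ⟨hx | hx, hxK⟩
    · exact Or.inl ⟨hx, hxK⟩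
    · exact Or.inr hx
  · rintro (⟨hx, hxK⟩ | hx)
    · exact ⟨Or.inl hx, hxK⟩
    · exact ⟨Or.inr hx, fun hxK => (Finset.mem_sdiff.1 (hY hx)).2 (Finset.mem_insert_of_mem (hKB hxK))⟩

/-- The off-coloop part of a target `Q ∪ Y` has `5 + |Y|` points. -/
theorem card_union_sdiff_coloops_eq (hG : G ∈ flatsQ M (5 + 1)) (hd : (gr M \ G).card = 2)
    (hk : kColoops M G = 1) {B : Finset α} (hB : B ∈ thinMembers M 5 G) (hnP : ¬ bigP M G B) {z : α}
    (hz : z ∈ G \ clF M B) {Y : Finset α} (hY : Y ⊆ G \ insert z B) :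
    ((insert z B ∪ Y) \ coloops M G).card = 5 + Y.card := by
  rw [union_sdiff_coloops_eq_of_subset hG hd hB hY]
  obtain ⟨-, hQ'5⟩ := rkN_insert_sdiff_coloops_eq_five hG hd hk hB hnP hz
  have hdisj : Disjoint (insert z B \ coloops M G) Y := by
    rw [Finset.disjoint_left]
    intro x hx hx'
    exact (Finset.mem_sdiff.1 (hY hx')).2 (Finset.mem_sdiff.1 hx).1
  rw [Finset.card_union_of_disjoint hdisj, hQ'5]

/-- **The four-point unloaded lemma, for any closure `ℓ = cl B₀`**: the target `Q ∪ (Y_D ∪ Y_O)` with `Y_D ⊆ W ∩ ℓ`,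
`|Y_D| ≥ 4`, `Y_O ⊆ W ∖ ℓ` and `|Y_O| > |Q′ ∩ ℓ|` is unloaded. -/
theorem dload_eq_zero_of_line_target_four (hG : G ∈ flatsQ M (5 + 1)) (hd : (gr M \ G).card = 2)
    (hk : kColoops M G = 1) (hs : ∀ e ∈ gr M, ∀ f ∈ gr M, e ≠ f → rkN M {e, f} = 2)
    (hl : ∀ e ∈ gr M, M.Indep {e}) (hfat : (fatClosures M 5 G 2).card ≤ 1) {B : Finset α}
    (hB : B ∈ thinMembers M 5 G) (hnP : ¬ bigP M G B) {z : α} (hz : z ∈ G \ clF M B) (B₀ : Finset α)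
    {YD YO : Finset α} (hYD : YD ⊆ (G \ insert z B) ∩ clF M B₀) (h4 : 4 ≤ YD.card)
    (hYO : YO ⊆ (G \ insert z B) \ clF M B₀)
    (hq : ((insert z B \ coloops M G) ∩ clF M B₀).card < YO.card) :
    dload M 5 G (bigP M G) (dshGT2 M 5 G) (insert z B ∪ (YD ∪ YO)) = 0 := by
  by_contra hne
  obtain ⟨R, hRT, hR2, hcard⟩ := exists_rank_two_of_dload_ne_zero hG hd hk hs hl hfat hne
  have hGg : G ⊆ gr M := (mem_flatsQ.1 hG).1
  have hBG : B ⊆ G := subset_G_of_mem_thinMembers hB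
  have hQG : insert z B ⊆ G := Finset.insert_subset (Finset.mem_sdiff.1 hz).1 hBG
  have hYDW : YD ⊆ G \ insert z B := hYD.trans Finset.inter_subset_left
  have hYOW : YO ⊆ G \ insert z B := hYO.trans Finset.sdiff_subset
  have hYW : YD ∪ YO ⊆ G \ insert z B := Finset.union_subset hYDW hYOW
  have hT'K := union_sdiff_coloops_eq_of_subset hG hd hB (z := z) hYW
  have hdisj : Disjoint YD YO := by
    rw [Finset.disjoint_left]
    intro x hx hx'
    exact (Finset.mem_sdiff.1 (hYO hx')).2 (Finset.mem_inter.1 (hYD hx)).2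
  have hcardT : ((insert z B ∪ (YD ∪ YO)) \ coloops M G).card = 5 + (YD.card + YO.card) := by
    rw [card_union_sdiff_coloops_eq hG hd hk hB hnP hz hYW, Finset.card_union_of_disjoint hdisj]
  have hind : M.Indep ((insert z B \ coloops M G : Finset α) : Set α) :=
    (indep_insert_of_basis_pair hG hd hk hB hnP hz).subset (by exact_mod_cast (Finset.sdiff_subset))
  have hRQ' : (R ∩ (insert z B \ coloops M G)).card ≤ 2 := by
    rw [Finset.inter_comm]
    exact card_inter_le_two_of_indep_of_rkN_le_two hind hR2.le
  have hRg : R ⊆ gr M :=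
    hRT.trans (Finset.sdiff_subset.trans ((Finset.union_subset hQG (hYW.trans Finset.sdiff_subset)).trans hGg))
  have hRsplit := Finset.card_sdiff_add_card_inter R (clF M B₀)
  -- the points of `R` off `ℓ` are basis points or points of `Y_O`
  have hoff : R \ clF M B₀ ⊆ (R ∩ (insert z B \ coloops M G)) ∪ YO := by
    intro r hr
    have hr' := Finset.mem_sdiff.1 hr
    have hrT := hRT hr'.1
    rw [hT'K, Finset.mem_union, Finset.mem_union] at hrT
    rcases hrT with h | h | h
    · exact Finset.mem_union_left _ (Finset.mem_inter.2 ⟨hr'.1, h⟩)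
    · exact absurd (Finset.mem_inter.1 (hYD h)).2 hr'.2
    · exact Finset.mem_union_right _ h
  have hoff_card : (R \ clF M B₀).card ≤ 2 + YO.card := by
    refine le_trans (Finset.card_le_card hoff) ?_
    refine le_trans (Finset.card_union_le _ _) ?_
    omega
  by_cases h2 : 2 ≤ (R ∩ clF M B₀).card
  · obtain ⟨r₁, hr₁, r₂, hr₂, hne12⟩ := Finset.one_lt_card.1 h2
    have hsub : R ⊆ clF M B₀ :=
      subset_clF_of_rkN_le_two_of_two_mem hs hRg hR2.le (Finset.mem_inter.1 hr₁).1
        (Finset.mem_inter.1 hr₂).1 hne12 (Finset.mem_inter.1 hr₁).2 (Finset.mem_inter.1 hr₂).2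
    have hin : R ⊆ ((insert z B \ coloops M G) ∩ clF M B₀) ∪ YD := by
      intro r hr
      have hrT := hRT hr
      rw [hT'K, Finset.mem_union, Finset.mem_union] at hrT
      rcases hrT with h | h | h
      · exact Finset.mem_union_left _ (Finset.mem_inter.2 ⟨h, hsub hr⟩)
      · exact Finset.mem_union_right _ h
      · exact absurd (hsub hr) (Finset.mem_sdiff.1 (hYO h)).2
    have h1 := Finset.card_le_card hin
    have h2' := Finset.card_union_le ((insert z B \ coloops M G) ∩ clF M B₀) YD
    omega
  · omega

/-- **Above the longest line every target is unloaded**: if every line `cl {x, y}` carries at most `L ≥ 1` points of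
`W`, a target `Q ∪ Y` with `|Y| ≥ L + 3` is unloaded (a load needs `≥ |Y| − 2 ≥ L + 1` collinear points of `Y`). -/
theorem dload_eq_zero_of_level_of_lines_le (hG : G ∈ flatsQ M (5 + 1)) (hd : (gr M \ G).card = 2)
    (hk : kColoops M G = 1) (hs : ∀ e ∈ gr M, ∀ f ∈ gr M, e ≠ f → rkN M {e, f} = 2)
    (hl : ∀ e ∈ gr M, M.Indep {e}) (hfat : (fatClosures M 5 G 2).card ≤ 1) {B : Finset α}
    (hB : B ∈ thinMembers M 5 G) (hnP : ¬ bigP M G B) {z : α} (hz : z ∈ G \ clF M B) {L : ℕ} (hL1 : 1 ≤ L)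
    (hL : ∀ x ∈ G, ∀ y ∈ G, x ≠ y → ((G \ insert z B) ∩ clF M {x, y}).card ≤ L)
    {Y : Finset α} (hY : Y ⊆ G \ insert z B) (hi : L + 3 ≤ Y.card) :
    dload M 5 G (bigP M G) (dshGT2 M 5 G) (insert z B ∪ Y) = 0 := by
  by_contra hne
  obtain ⟨R, hRT, hR2, hcard⟩ := exists_rank_two_of_dload_ne_zero hG hd hk hs hl hfat hne
  have hGg : G ⊆ gr M := (mem_flatsQ.1 hG).1
  have hBG : B ⊆ G := subset_G_of_mem_thinMembers hB
  have hQG : insert z B ⊆ G := Finset.insert_subset (Finset.mem_sdiff.1 hz).1 hBG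
  have hT'K := union_sdiff_coloops_eq_of_subset hG hd hB (z := z) hY
  have hcardT := card_union_sdiff_coloops_eq hG hd hk hB hnP hz hY
  have hind : M.Indep ((insert z B \ coloops M G : Finset α) : Set α) :=
    (indep_insert_of_basis_pair hG hd hk hB hnP hz).subset (by exact_mod_cast (Finset.sdiff_subset))
  have hRQ' : (R ∩ (insert z B \ coloops M G)).card ≤ 2 := by
    rw [Finset.inter_comm]
    exact card_inter_le_two_of_indep_of_rkN_le_two hind hR2.le
  have hRg : R ⊆ gr M :=
    hRT.trans (Finset.sdiff_subset.trans ((Finset.union_subset hQG (hY.trans Finset.sdiff_subset)).trans hGg))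
  have hRsub : R ⊆ (R ∩ (insert z B \ coloops M G)) ∪ (R ∩ Y) := by
    intro r hr
    have hrT := hRT hr
    rw [hT'K, Finset.mem_union] at hrT
    rcases hrT with h | h
    · exact Finset.mem_union_left _ (Finset.mem_inter.2 ⟨hr, h⟩)
    · exact Finset.mem_union_right _ (Finset.mem_inter.2 ⟨hr, h⟩)
  have hRY : L + 1 ≤ (R ∩ Y).card := by
    have h1 := Finset.card_le_card hRsub
    have h2 := Finset.card_union_le (R ∩ (insert z B \ coloops M G)) (R ∩ Y)
    omega
  obtain ⟨x, hx, y, hy, hxy⟩ := Finset.one_lt_card.1 (show 1 < (R ∩ Y).card by omega)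
  have hxW : x ∈ G \ insert z B := hY (Finset.mem_inter.1 hx).2
  have hyW : y ∈ G \ insert z B := hY (Finset.mem_inter.1 hy).2
  have hxG : x ∈ G := (Finset.mem_sdiff.1 hxW).1
  have hyG : y ∈ G := (Finset.mem_sdiff.1 hyW).1
  have hpair : ({x, y} : Finset α) ⊆ gr M := by
    intro e he
    rw [Finset.mem_insert, Finset.mem_singleton] at he
    rcases he with rfl | rfl
    · exact hGg hxG
    · exact hGg hyG
  have hxcl : x ∈ clF M {x, y} := subset_clF_of_subset_gr hpair (Finset.mem_insert_self _ _)
  have hycl : y ∈ clF M {x, y} :=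
    subset_clF_of_subset_gr hpair (Finset.mem_insert_of_mem (Finset.mem_singleton_self _))
  have hsub : R ⊆ clF M {x, y} :=
    subset_clF_of_rkN_le_two_of_two_mem hs hRg hR2.le (Finset.mem_inter.1 hx).1 (Finset.mem_inter.1 hy).1 hxy
      hxcl hycl
  have hRYsub : R ∩ Y ⊆ (G \ insert z B) ∩ clF M {x, y} := fun r hr =>
    Finset.mem_inter.2 ⟨hY (Finset.mem_inter.1 hr).2, hsub (Finset.mem_inter.1 hr).1⟩
  have h1 := Finset.card_le_card hRYsub
  have h2 := hL x hxG y hyG hxy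
  omega

/-- **The member faces inside `T` inject into the four-subsets of `T ∖ K`** (`B ↦ B ∖ K`). -/
theorem card_facesIn_le_choose (hG : G ∈ flatsQ M (5 + 1)) (hd : (gr M \ G).card = 2)
    (hk : kColoops M G = 1) (T : Finset α) :
    (facesIn M G T).card ≤ (T \ coloops M G).card.choose 4 := by
  have hd' : (gr M \ G).card ≤ 5 := by omega
  rw [← Finset.card_powersetCard]
  apply Finset.card_le_card_of_injOn (fun B => B \ coloops M G)
  · intro B hB
    rw [Finset.mem_coe] at hB
    unfold facesIn at hB
    rw [Finset.mem_filter] at hB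
    obtain ⟨hBthin, hnP, hBT⟩ := hB
    rw [Finset.mem_coe, Finset.mem_powersetCard]
    exact ⟨Finset.sdiff_subset_sdiff hBT (Finset.Subset.refl _),
      card_sdiff_eq_four_of_not_bigP hG hd hk hBthin hnP⟩
  · intro B₁ hB₁ B₂ hB₂ heq
    rw [Finset.mem_coe] at hB₁ hB₂
    unfold facesIn at hB₁ hB₂
    have hK₁ : coloops M G ⊆ B₁ := coloops_subset_of_mem_thinMembers hG hd' (Finset.mem_filter.1 hB₁).1
    have hK₂ : coloops M G ⊆ B₂ := coloops_subset_of_mem_thinMembers hG hd' (Finset.mem_filter.1 hB₂).1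
    simp only at heq
    rw [← Finset.sdiff_union_of_subset hK₁, ← Finset.sdiff_union_of_subset hK₂, heq]

/-- **The face sum is at most a third of `C(|T ∖ K|, 4)`** (no fat closure). -/
theorem faceSum_le_third_mul_choose (hG : G ∈ flatsQ M (5 + 1)) (hd : (gr M \ G).card = 2)
    (hk : kColoops M G = 1) (hnf : fatClosures M 5 G 2 = ∅) {T : Finset α} (hTG : T ⊆ G) :
    faceSum M G T ≤ 1 / 3 * (((T \ coloops M G).card.choose 4 : ℕ) : ℚ) := by
  refine le_trans (faceSum_le_third_mul_card_facesIn hG hd hnf hTG) ?_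
  apply mul_le_mul_of_nonneg_left _ (by norm_num)
  exact_mod_cast card_facesIn_le_choose hG hd hk T

end PercRepro.Shadow
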